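import Summits.BirchSwinnertonDyer.BirchSwinnertonDyer.Theorems.AlignedTransportAtTwoMainConjectureOfRankZeroBSDAtTwoLayerValueTrichotomy
import Summits.BirchSwinnertonDyer.BirchSwinnertonDyer.Theorems.AlignedTransportAtTwoMainConjectureOfRankZeroBSDAtTwoTwinValueAnalytic
import Summits.BirchSwinnertonDyer.Rank1Residual.Iwasawa.LambdaInvariantValuationTwisted
import HarnessLib

/-!
# Route `AlignedTransportAtTwo`, crux C2 `MainConjectureOfRankZeroBSDAtTwo` (stmt-BirchSwinnertonDyer-22298):
# THE LAYER-VALUE BOUNDARY CERTIFICATE FOR BIRCH SUMS — ONE twisted special value `∑_a χ(a)[a/p^m]⁺_f` AT the boundary valuation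
# `V = φ(pⁿ⁺¹)` certifies `μ = 0` AND `λ = φ(pⁿ⁺¹)` for (an integral model of) a `p`-adic `L`-function, any good prime `p`;
# at `p = 2`: the Birch sum of ONE even character of conductor `2ⁿ⁺³` with `v₂ = 2ⁿ/φ…` decides C2's analytic-`μ` binder and `λ_an = 2ⁿ`

HONEST FRAMING (cell `bsd-f1-sign2`, WIDTH-5 attached prover seat `bsd-line-att-p5` gen 50 on line `birth` of the lead
`bsd-line-att-p2`; `--supports` stmt-BirchSwinnertonDyer-22298, closes nothing; BSD is NOT proved by any of this; the crux C2, its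
verdict «blocked-on `Rank1Residual.GreenbergMuConjectureIrreducible`» and every registered stub (P / T / Kμ / LimDoor / MuIneqʳ / PFμ⁺)
are untouched). THEOREMS ONLY — no `def`, no instance, no named fact, no `sorry`; NO PRINT binder anywhere in this file: the
Mazur–Tate–Teitelbaum interpolation at `p`-power conductors is the tree theorem `isPAdicLFunctionOf_padicLFunction_holds`, read through
the b2b plumbing `Iwasawa.hasSum_integralModel_eq_ratTwistedSymbolSum` / `isPrimitiveRoot_apply_cyclotomicGenerator`; the Λ-algebra is
the sibling `…LayerValueBoundary`.

THE POINT. The tree's part 3 (`Iwasawa/LambdaInvariantValuationTwisted`, b2b ENGINE-T in the kernel) reads `(μ, λ)` of an integral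
model `G` (`ι(G) = ϖ·L`) of a `p`-adic `L`-function `L` off ONE Birch sum `B(χ) = ϖ·α^{−m}·∑_a χ(a)[a/p^m]⁺_f` (`χ` primitive, even, of
`p`-power order, conductor `p^m = p^{n+1+e₀}`, so `χ(γ)` has order `pⁿ⁺¹` and `G(χ(γ) − 1) = B(χ)`): `|B(χ)|^{φ(pⁿ⁺¹)} = p^{−V}` with `V < φ`
gives `μ(G) = 0 ∧ λ(G) = V`; `V ≥ φ` is «undetermined». By `…LayerValueBoundary` the boundary row is decided:

* §1 (any `p`, any `(f, α)` with the twisted interpolation clause `hI`) ★★★ `mu_eq_zero_and_lam_eq_totient_of_norm_twist_eq_inv`: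
  **`|B(χ)| = 1/p` and `|G(0)| ≠ 1/p` ⟹ `μ(G) = 0 ∧ λ(G) = φ(pⁿ⁺¹)`**; integer form with the EXTENDED RANGE `V ≤ φ`
  (`mu_eq_zero_and_lam_eq_of_norm_twist_pow_eq_of_le`); the CLOSED `μ`-certificate `|B(χ)| ≥ 1/p ∧ |G(0)| ≠ 1/p ⟹ μ(G) = 0`
  (`mu_eq_zero_of_inv_le_norm_twist`).
* §2 (good ORDINARY `p`, `α = unitRoot`, a unit: the statements are about `|ϖ·∑_a χ(a)[a/p^m]⁺_f|`) the same three
  (`ordinary_mu_eq_zero_and_lam_eq_totient_of_norm_twist_eq_inv`, `ordinary_mu_eq_zero_and_lam_eq_of_norm_twist_pow_eq_of_le`,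
  `ordinary_mu_eq_zero_of_inv_le_norm_twist`).
* §3 (`p = 2`, C2's binder object: `W/ℚ` good at `2`, `f` its newform at level `N_W`, `G` an even-branch lift, `ι(G) = L₂(f, α)`, `ϖ = 1`;
  `e₀ = cyclotomicExponent 2 = 2`, so `χ` has conductor `2ⁿ⁺³`) ★★★ `red_ne_zero_and_lam_eq_of_isEvenBranchLiftAtTwo_of_norm_twist_eq_inv`:
  **`‖∑_a χ(a)[a/2ⁿ⁺³]⁺_f‖₂ = 1/2` and `‖G(0)‖₂ ≠ 1/2` ⟹ `red G ≠ 0` (`μ_an = 0`) `∧ λ(G) = 2ⁿ`** — at `n = 1` (conductor `16`): `λ_an = 2`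
  from ONE Birch sum of valuation exactly `1`; ★★ `red_ne_zero_of_isEvenBranchLiftAtTwo_of_inv_le_norm_twist` (closed `μ_an`-certificate);
  ★★ `muAn_binder_of_layerValue`: C2's analytic-`μ` binder verbatim (all levels, via Carayol `hlev`) from, per even-branch lift, ONE Birch
  sum with `‖·‖₂ ≥ 1/2` and `‖G(0)‖₂ ≠ 1/2` (`G(0) = (1 − α⁻¹)²[0]⁺_f`, tree `constantCoeff_reading`; on the good ordinary cell `(1 − α⁻¹)² ∈ 4ℤ₂`,
  so the side condition holds as soon as `[0]⁺_f ∈ ℤ₂`).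

So at `p = 2` the b2b / bsd-2adic engines' boundary row «`V = e_n`» is DECIDED: `v₂(Norm_{ℚ(χ)/ℚ} B(χ)) = 2ⁿ` at conductor `2ⁿ⁺³` certifies
`μ_an = 0 ∧ λ_an = 2ⁿ` — each `λ_an = 2ⁿ` one layer (one conductor exponent) earlier than the strict rule. Memo
`Cruxes/MainConjectureOfRankZeroBSDAtTwo/LAYER-VALUE-att-p5-g50.md`. BSD is not proved by any of this; nothing about any particular curve is
asserted here.

References (ATTRIBUTION; proofs self-contained over the tree): B. Mazur, J. Tate, J. Teitelbaum, Invent. Math. 84 (1986) §I.13–I.14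
[MazurTateTeitelbaum1986Invent]; B. Mazur, P. Swinnerton-Dyer, Invent. Math. 25 (1974) §9 [MazurSwinnertonDyer1974Invent]; L. Washington,
GTM 83, §7.1–7.2 [Washington1997]; R. Pollack, Duke Math. J. 118 (2003) Prop. 6.9–6.10 [Pollack2003]; H. Carayol, Ann. Sci. ÉNS 19 (1986)
[Carayol1986]; tree `Iwasawa/LambdaInvariantValuationTwisted.lean`, `…TwinValueAnalytic.lean`.
-/

set_option linter.dupNamespace false
set_option autoImplicit false

noncomputable section

open scoped Classical MatrixGroups ModularForm

namespace Summit.BirchSwinnertonDyer.BirchSwinnertonDyer.Theorems.AlignedTransportAtTwoLayerValueAnalytic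

open PowerSeries CongruenceSubgroup Polynomial WeierstrassCurve Literature.NumberTheory.EllipticCurves
  Literature.NumberTheory.EllipticCurves.IwasawaAlgebra
  Literature.NumberTheory.EllipticCurves.ModularForms
  Literature.NumberTheory.EllipticCurves.GreenbergVatsal2000
  Summit.BirchSwinnertonDyer.Rank1Residual
  Summit.BirchSwinnertonDyer.Rank1Residual.X1.MuLambda
  Summit.BirchSwinnertonDyer.Rank1Residual.X11a
  Summit.BirchSwinnertonDyer.Rank1Residual.F1Sign2
  Summit.BirchSwinnertonDyer.Rank1Residual.Iwasawa
  Summit.BirchSwinnertonDyer.Rank1Residual.Supersingular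
  Summit.BirchSwinnertonDyer.BirchSwinnertonDyer.Theorems
  Summit.BirchSwinnertonDyer.BirchSwinnertonDyer.Theorems.AlignedTransportAtTwoRoadSecondFixedPoint
  Summit.BirchSwinnertonDyer.BirchSwinnertonDyer.Theorems.AlignedTransportAtTwoTwinValueAnalytic
  Summit.BirchSwinnertonDyer.BirchSwinnertonDyer.Theorems.AlignedTransportAtTwoLayerValueBoundary
  Summit.BirchSwinnertonDyer.BirchSwinnertonDyer.Theorems.AlignedTransportAtTwoLayerValueTrichotomy
  Summit.BirchSwinnertonDyer.BirchSwinnertonDyer.Theorems.LambdaTransportDoorAtTwoMatsunoClassSign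

/-! ## §1 Any good prime: the boundary certificate for one Birch sum -/

section Twists

variable {p : ℕ} [hp : Fact p.Prime] {N : ℕ} {f : CuspForm (Gamma0 N) 2}

/-- ★★★ **THE BOUNDARY CERTIFICATE FOR ONE BIRCH SUM** (any `p`). `L ∈ ℚ_p⟦T⟧` with the twisted interpolation clause `hI` for `(f, α)`,
integral model `ι(G) = ϖ·L`, `G ≠ 0`; `χ` a primitive even `p`-power-order character of conductor `p^{n+1+e₀}` with values in `ℂ_p`. If
**`|ϖ·α^{−(n+1+e₀)}·∑_a χ(a)[a/p^{n+1+e₀}]⁺_f| = 1/p`** and **`|G(0)| ≠ 1/p`**, then **`μ(G) = 0` and `λ(G) = φ(pⁿ⁺¹)`** — the row `V = φ(pⁿ⁺¹)`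
that the tree's `mu_eq_zero_and_lam_eq_of_norm_twist_pow_eq` (`V < φ`) leaves undetermined.
[cite: MazurTateTeitelbaum1986Invent, §I.13–I.14] [cite: Washington1997, §7.1–7.2 and Thm. 7.3] -/
theorem mu_eq_zero_and_lam_eq_totient_of_norm_twist_eq_inv {α : ℚ_[p]} {L : PowerSeries ℚ_[p]}
    (hI : ∀ (m : ℕ), 0 < m → ∀ χ : DirichletCharacter ℂ_[p] (p ^ m), χ.IsPrimitive → χ.Even →
      (∃ j : ℕ, orderOf χ = p ^ j) →
        HasSum (fun k : ℕ ↦ algebraMap ℚ_[p] ℂ_[p] (PowerSeries.coeff k L) *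
            (χ (cyclotomicGenerator p : ZMod (p ^ m)) - 1) ^ k)
          (algebraMap ℚ_[p] ℂ_[p] (α⁻¹ ^ m) * ratTwistedSymbolSum f χ))
    {G : IwasawaAlgebra p} {ϖ : ℚ_[p]} (hG : iwasawaToPowerSeries p G = PowerSeries.C ϖ * L)
    (hG0 : G ≠ 0) {n : ℕ} (χ : DirichletCharacter ℂ_[p] (p ^ (n + 1 + cyclotomicExponent p)))
    (hχ : χ.IsPrimitive) (heven : χ.Even) (hord : ∃ j : ℕ, orderOf χ = p ^ j)
    (h : ‖algebraMap ℚ_[p] ℂ_[p] ϖ * (algebraMap ℚ_[p] ℂ_[p] (α⁻¹ ^ (n + 1 + cyclotomicExponent p)) *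
      ratTwistedSymbolSum f χ)‖ = (p : ℝ)⁻¹)
    (h0 : ‖((algebraMap ℚ_[p] ℂ_[p]).comp (algebraMap ℤ_[p] ℚ_[p])) (PowerSeries.constantCoeff G)‖ ≠ (p : ℝ)⁻¹) :
    mu G = 0 ∧ lam G = Nat.totient (p ^ (n + 1)) := by
  have hm : 0 < n + 1 + cyclotomicExponent p := by omega
  rw [← (hasSum_integralModel_eq_ratTwistedSymbolSum hI hG hm χ hχ heven hord).tsum_eq] at h
  exact mu_eq_zero_and_lam_eq_totient_of_norm_tsum_eq_inv hG0 (isPrimitiveRoot_apply_cyclotomicGenerator χ hχ heven hord) h h0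

/-- ★★★ **Integer form with the EXTENDED RANGE**: `|ϖ·α^{−m}·Birch(χ)|^{φ(pⁿ⁺¹)} = p^{−V}` with **`V ≤ φ(pⁿ⁺¹)`** and `|G(0)| ≠ 1/p` ⟹
`μ(G) = 0 ∧ λ(G) = V`. [cite: MazurTateTeitelbaum1986Invent, §I.13–I.14] [cite: Washington1997, §7.1–7.2 and Thm. 7.3] -/
theorem mu_eq_zero_and_lam_eq_of_norm_twist_pow_eq_of_le {α : ℚ_[p]} {L : PowerSeries ℚ_[p]}
    (hI : ∀ (m : ℕ), 0 < m → ∀ χ : DirichletCharacter ℂ_[p] (p ^ m), χ.IsPrimitive → χ.Even →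
      (∃ j : ℕ, orderOf χ = p ^ j) →
        HasSum (fun k : ℕ ↦ algebraMap ℚ_[p] ℂ_[p] (PowerSeries.coeff k L) *
            (χ (cyclotomicGenerator p : ZMod (p ^ m)) - 1) ^ k)
          (algebraMap ℚ_[p] ℂ_[p] (α⁻¹ ^ m) * ratTwistedSymbolSum f χ))
    {G : IwasawaAlgebra p} {ϖ : ℚ_[p]} (hG : iwasawaToPowerSeries p G = PowerSeries.C ϖ * L)
    (hG0 : G ≠ 0) {n : ℕ} (χ : DirichletCharacter ℂ_[p] (p ^ (n + 1 + cyclotomicExponent p)))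
    (hχ : χ.IsPrimitive) (heven : χ.Even) (hord : ∃ j : ℕ, orderOf χ = p ^ j) {V : ℕ}
    (hV : V ≤ Nat.totient (p ^ (n + 1)))
    (h : ‖algebraMap ℚ_[p] ℂ_[p] ϖ * (algebraMap ℚ_[p] ℂ_[p] (α⁻¹ ^ (n + 1 + cyclotomicExponent p)) *
      ratTwistedSymbolSum f χ)‖ ^ Nat.totient (p ^ (n + 1)) = ((p : ℝ)⁻¹) ^ V)
    (h0 : ‖((algebraMap ℚ_[p] ℂ_[p]).comp (algebraMap ℤ_[p] ℚ_[p])) (PowerSeries.constantCoeff G)‖ ≠ (p : ℝ)⁻¹) :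
    mu G = 0 ∧ lam G = V := by
  have hm : 0 < n + 1 + cyclotomicExponent p := by omega
  rw [← (hasSum_integralModel_eq_ratTwistedSymbolSum hI hG hm χ hχ heven hord).tsum_eq] at h
  exact mu_eq_zero_and_lam_eq_of_norm_tsum_pow_eq_of_le hG0 (isPrimitiveRoot_apply_cyclotomicGenerator χ hχ heven hord) hV h h0

/-- ★★ **The CLOSED `μ`-certificate for one Birch sum**: `|ϖ·α^{−m}·Birch(χ)| ≥ 1/p` and `|G(0)| ≠ 1/p` ⟹ `μ(G) = 0` (the tree's
`mu_eq_zero_and_lam_lt_totient_of_lt_norm_twist` needs `> 1/p`). [cite: MazurTateTeitelbaum1986Invent, §I.13–I.14]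
[cite: Washington1997, §7.1–7.2 and Thm. 7.3] -/
theorem mu_eq_zero_of_inv_le_norm_twist {α : ℚ_[p]} {L : PowerSeries ℚ_[p]}
    (hI : ∀ (m : ℕ), 0 < m → ∀ χ : DirichletCharacter ℂ_[p] (p ^ m), χ.IsPrimitive → χ.Even →
      (∃ j : ℕ, orderOf χ = p ^ j) →
        HasSum (fun k : ℕ ↦ algebraMap ℚ_[p] ℂ_[p] (PowerSeries.coeff k L) *
            (χ (cyclotomicGenerator p : ZMod (p ^ m)) - 1) ^ k)
          (algebraMap ℚ_[p] ℂ_[p] (α⁻¹ ^ m) * ratTwistedSymbolSum f χ))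
    {G : IwasawaAlgebra p} {ϖ : ℚ_[p]} (hG : iwasawaToPowerSeries p G = PowerSeries.C ϖ * L)
    (hG0 : G ≠ 0) {n : ℕ} (χ : DirichletCharacter ℂ_[p] (p ^ (n + 1 + cyclotomicExponent p)))
    (hχ : χ.IsPrimitive) (heven : χ.Even) (hord : ∃ j : ℕ, orderOf χ = p ^ j)
    (h : (p : ℝ)⁻¹ ≤ ‖algebraMap ℚ_[p] ℂ_[p] ϖ * (algebraMap ℚ_[p] ℂ_[p] (α⁻¹ ^ (n + 1 + cyclotomicExponent p)) *
      ratTwistedSymbolSum f χ)‖)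
    (h0 : ‖((algebraMap ℚ_[p] ℂ_[p]).comp (algebraMap ℤ_[p] ℚ_[p])) (PowerSeries.constantCoeff G)‖ ≠ (p : ℝ)⁻¹) :
    mu G = 0 := by
  have hm : 0 < n + 1 + cyclotomicExponent p := by omega
  rw [← (hasSum_integralModel_eq_ratTwistedSymbolSum hI hG hm χ hχ heven hord).tsum_eq] at h
  exact mu_eq_zero_of_inv_le_norm_tsum hG0
    (norm_sub_one_pos_and_lt_one (isPrimitiveRoot_apply_cyclotomicGenerator χ hχ heven hord)).2 h h0

end Twists

/-! ## §2 Good ordinary `p`: `α = unitRoot` is a unit, so the statements are about `|ϖ·∑_a χ(a)[a/p^m]⁺_f|` -/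

section Ordinary

variable {p : ℕ} [hp : Fact p.Prime] {N : ℕ} [NeZero N] {f : CuspForm (Gamma0 N) 2} {W : WeierstrassCurve ℚ} [W.IsElliptic]
  [W.IsGloballyMinimal]

/-- ★★★ **Good ordinary `p`: ONE Birch sum at the boundary valuation certifies `μ = 0` and `λ = φ(pⁿ⁺¹)`.** `G` an integral model of
`L_p(E,T) = padicLFunction f (unitRoot W p)` (`ι(G) = ϖ·L_p`, `G ≠ 0`; interpolation = tree theorem): if `|ϖ·∑_a χ(a)[a/p^{n+1+e₀}]⁺_f| = 1/p` for
one primitive even `p`-power-order `χ` of conductor `p^{n+1+e₀}` and `|G(0)| ≠ 1/p`, then `μ(G) = 0 ∧ λ(G) = φ(pⁿ⁺¹)`.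
[cite: MazurSwinnertonDyer1974Invent, §9] [cite: MazurTateTeitelbaum1986Invent, §I.14 (14.3)] -/
theorem ordinary_mu_eq_zero_and_lam_eq_totient_of_norm_twist_eq_inv (hord : IsOrdinaryAt W p) (hf : IsNewformOf W f)
    {G : IwasawaAlgebra p} {ϖ : ℚ_[p]} (hG : iwasawaToPowerSeries p G = PowerSeries.C ϖ * padicLFunction f (unitRoot W p : ℚ_[p]))
    (hG0 : G ≠ 0) {n : ℕ} (χ : DirichletCharacter ℂ_[p] (p ^ (n + 1 + cyclotomicExponent p)))
    (hχ : χ.IsPrimitive) (heven : χ.Even) (hordχ : ∃ j : ℕ, orderOf χ = p ^ j)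
    (h : ‖algebraMap ℚ_[p] ℂ_[p] ϖ * ratTwistedSymbolSum f χ‖ = (p : ℝ)⁻¹)
    (h0 : ‖((algebraMap ℚ_[p] ℂ_[p]).comp (algebraMap ℤ_[p] ℚ_[p])) (PowerSeries.constantCoeff G)‖ ≠ (p : ℝ)⁻¹) :
    mu G = 0 ∧ lam G = Nat.totient (p ^ (n + 1)) := by
  refine mu_eq_zero_and_lam_eq_totient_of_norm_twist_eq_inv (isPAdicLFunctionOf_padicLFunction_holds hord hf).2 hG hG0 χ hχ heven
    hordχ ?_ h0
  rw [norm_mul, norm_mul, norm_algebraMap_unitRoot_inv_pow hord, one_mul, ← norm_mul, h]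

/-- ★★★ **Good ordinary `p`, integer form with the extended range**: `|ϖ·∑_a χ(a)[a/p^{n+1+e₀}]⁺_f|^{φ(pⁿ⁺¹)} = p^{−V}` with `V ≤ φ(pⁿ⁺¹)` and
`|G(0)| ≠ 1/p` ⟹ `μ(G) = 0 ∧ λ(G) = V` (the tree's `ordinary_mu_eq_zero_and_lam_eq_of_norm_twist_pow_eq` is `V < φ`).
[cite: MazurSwinnertonDyer1974Invent, §9] [cite: MazurTateTeitelbaum1986Invent, §I.14 (14.3)] -/
theorem ordinary_mu_eq_zero_and_lam_eq_of_norm_twist_pow_eq_of_le (hord : IsOrdinaryAt W p) (hf : IsNewformOf W f)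
    {G : IwasawaAlgebra p} {ϖ : ℚ_[p]} (hG : iwasawaToPowerSeries p G = PowerSeries.C ϖ * padicLFunction f (unitRoot W p : ℚ_[p]))
    (hG0 : G ≠ 0) {n : ℕ} (χ : DirichletCharacter ℂ_[p] (p ^ (n + 1 + cyclotomicExponent p)))
    (hχ : χ.IsPrimitive) (heven : χ.Even) (hordχ : ∃ j : ℕ, orderOf χ = p ^ j) {V : ℕ} (hV : V ≤ Nat.totient (p ^ (n + 1)))
    (h : ‖algebraMap ℚ_[p] ℂ_[p] ϖ * ratTwistedSymbolSum f χ‖ ^ Nat.totient (p ^ (n + 1)) = ((p : ℝ)⁻¹) ^ V)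
    (h0 : ‖((algebraMap ℚ_[p] ℂ_[p]).comp (algebraMap ℤ_[p] ℚ_[p])) (PowerSeries.constantCoeff G)‖ ≠ (p : ℝ)⁻¹) :
    mu G = 0 ∧ lam G = V := by
  refine mu_eq_zero_and_lam_eq_of_norm_twist_pow_eq_of_le (isPAdicLFunctionOf_padicLFunction_holds hord hf).2 hG hG0 χ hχ heven
    hordχ hV ?_ h0
  rw [norm_mul, norm_mul, norm_algebraMap_unitRoot_inv_pow hord, one_mul, ← norm_mul, h]

/-- ★★ **Good ordinary `p`, closed `μ`-certificate**: `|ϖ·∑_a χ(a)[a/p^{n+1+e₀}]⁺_f| ≥ 1/p` and `|G(0)| ≠ 1/p` ⟹ `μ(G) = 0`.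
[cite: MazurSwinnertonDyer1974Invent, §9] [cite: MazurTateTeitelbaum1986Invent, §I.14 (14.3)] -/
theorem ordinary_mu_eq_zero_of_inv_le_norm_twist (hord : IsOrdinaryAt W p) (hf : IsNewformOf W f)
    {G : IwasawaAlgebra p} {ϖ : ℚ_[p]} (hG : iwasawaToPowerSeries p G = PowerSeries.C ϖ * padicLFunction f (unitRoot W p : ℚ_[p]))
    (hG0 : G ≠ 0) {n : ℕ} (χ : DirichletCharacter ℂ_[p] (p ^ (n + 1 + cyclotomicExponent p)))
    (hχ : χ.IsPrimitive) (heven : χ.Even) (hordχ : ∃ j : ℕ, orderOf χ = p ^ j)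
    (h : (p : ℝ)⁻¹ ≤ ‖algebraMap ℚ_[p] ℂ_[p] ϖ * ratTwistedSymbolSum f χ‖)
    (h0 : ‖((algebraMap ℚ_[p] ℂ_[p]).comp (algebraMap ℤ_[p] ℚ_[p])) (PowerSeries.constantCoeff G)‖ ≠ (p : ℝ)⁻¹) :
    mu G = 0 := by
  refine mu_eq_zero_of_inv_le_norm_twist (isPAdicLFunctionOf_padicLFunction_holds hord hf).2 hG hG0 χ hχ heven hordχ ?_ h0
  rw [norm_mul, norm_mul, norm_algebraMap_unitRoot_inv_pow hord, one_mul, ← norm_mul]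
  exact h

end Ordinary

/-! ## §3 `p = 2`, C2's binder object: even-branch lifts of `L₂(f, α)` -/

section EvenBranch

variable {W : WeierstrassCurve ℚ} [W.IsElliptic] [W.IsGloballyMinimal] [NeZero (W.conductorNorm ℤ)]
  {f : CuspForm (Gamma0 (W.conductorNorm ℤ)) 2}

/-- The `ℂ₂`-norm of the constant term of `G ∈ ℤ₂⟦T⟧` is its `ℤ₂`-norm. [folklore] -/
theorem norm_algebraMap_constantCoeff_eq (G : IwasawaAlgebra 2) :
    ‖((algebraMap ℚ_[2] ℂ_[2]).comp (algebraMap ℤ_[2] ℚ_[2])) (PowerSeries.constantCoeff G)‖ = ‖PowerSeries.constantCoeff G‖ :=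
  norm_algebraMap_comp_apply _

/-- ★★★ **C2's binder object, ONE Birch sum at the boundary: `red G ≠ 0` (`μ_an = 0`) AND `λ(G) = 2ⁿ`.** `W/ℚ` globally minimal, good
at `2`, `f` its newform at level `N_W`, `G ≠ 0` an even-branch lift (`IsEvenBranchLiftAtTwo W f G`: `ι(G) = L₂(f, α)`, `α` the unit root);
`χ` a primitive even `2`-power-order Dirichlet character of conductor `2ⁿ⁺³` (`= 2^{n+1+e₀}`, `e₀ = 2`) with values in `ℂ₂`. If
**`‖∑_a χ(a)[a/2ⁿ⁺³]⁺_f‖₂ = 1/2`** and **`‖G(0)‖₂ ≠ 1/2`** (`G(0) = (1 − α⁻¹)²[0]⁺_f`), then **`red G ≠ 0` and `λ(G) = 2ⁿ`**: at `n = 1`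
(conductor `16`) `λ_an = 2` from one Birch sum of `2`-adic valuation exactly `1`. NO PRINT binder.
[cite: MazurTateTeitelbaum1986Invent, §I.14 (14.3)] [cite: Washington1997, §7.1–7.2 and Thm. 7.3] -/
theorem red_ne_zero_and_lam_eq_of_isEvenBranchLiftAtTwo_of_norm_twist_eq_inv (hgood : W.HasGoodReductionAtPrime 2)
    (hf : IsNewformOf W f) {G : IwasawaAlgebra 2} (hG : IsEvenBranchLiftAtTwo W f G) (hG0 : G ≠ 0) {n : ℕ}
    (χ : DirichletCharacter ℂ_[2] (2 ^ (n + 1 + cyclotomicExponent 2))) (hχ : χ.IsPrimitive) (heven : χ.Even)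
    (hordχ : ∃ j : ℕ, orderOf χ = 2 ^ j) (h : ‖ratTwistedSymbolSum f χ‖ = ((2 : ℕ) : ℝ)⁻¹)
    (h0 : ‖PowerSeries.constantCoeff G‖ ≠ ((2 : ℕ) : ℝ)⁻¹) :
    red G ≠ 0 ∧ lam G = 2 ^ n := by
  obtain ⟨hord, hιG⟩ := isOrdinaryAt_and_eq_of_isEvenBranchLiftAtTwo hgood hG
  have h0' : ‖((algebraMap ℚ_[2] ℂ_[2]).comp (algebraMap ℤ_[2] ℚ_[2])) (PowerSeries.constantCoeff G)‖ ≠ ((2 : ℕ) : ℝ)⁻¹ := by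
    rw [norm_algebraMap_constantCoeff_eq]; exact h0
  have h1 : ‖algebraMap ℚ_[2] ℂ_[2] (1 : ℚ_[2]) * ratTwistedSymbolSum f χ‖ = ((2 : ℕ) : ℝ)⁻¹ := by
    rw [map_one, one_mul]; exact h
  obtain ⟨hμ, hlam⟩ := ordinary_mu_eq_zero_and_lam_eq_totient_of_norm_twist_eq_inv hord hf hιG hG0 χ hχ heven hordχ h1 h0'
  refine ⟨red_ne_zero_of_mu_zero hG0 hμ, ?_⟩
  rw [hlam, Nat.totient_prime_pow Nat.prime_two (Nat.succ_pos n)]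
  simp

/-- ★★ **C2's binder object, the CLOSED `μ_an`-certificate**: same setting; `‖∑_a χ(a)[a/2ⁿ⁺³]⁺_f‖₂ ≥ 1/2` and `‖G(0)‖₂ ≠ 1/2` ⟹ `red G ≠ 0`
(`μ_an = 0`). [cite: MazurTateTeitelbaum1986Invent, §I.14 (14.3)] [cite: Washington1997, §7.1–7.2 and Thm. 7.3] -/
theorem red_ne_zero_of_isEvenBranchLiftAtTwo_of_inv_le_norm_twist (hgood : W.HasGoodReductionAtPrime 2) (hf : IsNewformOf W f)
    {G : IwasawaAlgebra 2} (hG : IsEvenBranchLiftAtTwo W f G) (hG0 : G ≠ 0) {n : ℕ}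
    (χ : DirichletCharacter ℂ_[2] (2 ^ (n + 1 + cyclotomicExponent 2))) (hχ : χ.IsPrimitive) (heven : χ.Even)
    (hordχ : ∃ j : ℕ, orderOf χ = 2 ^ j) (h : ((2 : ℕ) : ℝ)⁻¹ ≤ ‖ratTwistedSymbolSum f χ‖)
    (h0 : ‖PowerSeries.constantCoeff G‖ ≠ ((2 : ℕ) : ℝ)⁻¹) : red G ≠ 0 := by
  obtain ⟨hord, hιG⟩ := isOrdinaryAt_and_eq_of_isEvenBranchLiftAtTwo hgood hG
  have h0' : ‖((algebraMap ℚ_[2] ℂ_[2]).comp (algebraMap ℤ_[2] ℚ_[2])) (PowerSeries.constantCoeff G)‖ ≠ ((2 : ℕ) : ℝ)⁻¹ := by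
    rw [norm_algebraMap_constantCoeff_eq]; exact h0
  have h1 : ((2 : ℕ) : ℝ)⁻¹ ≤ ‖algebraMap ℚ_[2] ℂ_[2] (1 : ℚ_[2]) * ratTwistedSymbolSum f χ‖ := by
    rw [map_one, one_mul]; exact h
  exact red_ne_zero_of_mu_zero hG0 (ordinary_mu_eq_zero_of_inv_le_norm_twist hord hf hιG hG0 χ hχ heven hordχ h1 h0')

end EvenBranch

/-! ## §4 C2's analytic-`μ` binder verbatim (all levels, via Carayol) -/

section Binder

variable (W : WeierstrassCurve ℚ) [W.IsElliptic] [W.IsGloballyMinimal]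

/-- ★★ **C2's analytic-`μ` binder from ONE layer value, all levels.** `W/ℚ` globally minimal, good at `2`; Carayol's level theorem `hlev`
(`IsNewformOf.level_eq_conductorNorm`, PRINT). If EVERY even-branch lift `G` of `L₂` of the conductor-level newform is non-zero and carries ONE
primitive even `2`-power-order `χ` of some conductor `2ⁿ⁺³` with **`‖∑_a χ(a)[a/2ⁿ⁺³]⁺_f‖₂ ≥ 1/2`** and `‖G(0)‖₂ ≠ 1/2` (a per-curve modular-symbol
condition), then the binder of crux C2 holds for `W`: `∀ N f, IsNewformOf W f → ∀ G, IsEvenBranchLiftAtTwo W f G → red G ≠ 0`.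
[cite: Carayol1986, Thm. (A)] [cite: MazurTateTeitelbaum1986Invent, §I.14 (14.3)] -/
theorem muAn_binder_of_layerValue (hlev : ∀ {N : ℕ} [NeZero N], IsNewformOf.level_eq_conductorNorm (N := N))
    (hgood : W.HasGoodReductionAtPrime 2)
    (hval : ∀ [NeZero (W.conductorNorm ℤ)] (f : CuspForm (Gamma0 (W.conductorNorm ℤ)) 2), IsNewformOf W f →
      ∀ G : IwasawaAlgebra 2, IsEvenBranchLiftAtTwo W f G →
        G ≠ 0 ∧ ‖PowerSeries.constantCoeff G‖ ≠ ((2 : ℕ) : ℝ)⁻¹ ∧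
        ∃ (n : ℕ) (χ : DirichletCharacter ℂ_[2] (2 ^ (n + 1 + cyclotomicExponent 2))), χ.IsPrimitive ∧ χ.Even ∧
          (∃ j : ℕ, orderOf χ = 2 ^ j) ∧ ((2 : ℕ) : ℝ)⁻¹ ≤ ‖ratTwistedSymbolSum f χ‖) :
    ∀ ⦃N : ℕ⦄ [NeZero N] (f : CuspForm (Gamma0 N) 2), IsNewformOf W f →
      ∀ G : IwasawaAlgebra 2, IsEvenBranchLiftAtTwo W f G → red G ≠ 0 := by
  intro N _ f hf G hG
  have hN : N = W.conductorNorm ℤ := hlev hf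
  subst hN
  obtain ⟨hG0, h0, n, χ, hχ, heven, hordχ, h⟩ := hval f hf G hG
  exact red_ne_zero_of_isEvenBranchLiftAtTwo_of_inv_le_norm_twist hgood hf hG hG0 χ hχ heven hordχ h h0

end Binder

end Summit.BirchSwinnertonDyer.BirchSwinnertonDyer.Theorems.AlignedTransportAtTwoLayerValueAnalytic

end
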